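import Literature.NumberTheory.Automorphic.Liu2021.CheckOfChiConjugateOrthogonal
import Literature.NumberTheory.Automorphic.Liu2021.CheckOfChiLocal
import Literature.RepresentationTheory.HarrisKudlaSweet1996.SplittingCharactersCM
import HarnessLib

/-!
# The companion label `μᶜ·χ̌` of [Liu2021, Lem. D.1 (4)] as a unitary idèle-class character: conjugate-symplectic, same weight, CM type `Φ̄_μ`

[Liu2021, Lemma D.1 (4) (l. 5235)]: the local oscillator representations attached to `(μ, ε, χ)` and to the companion triple
`(μᶜ·χ̌, ε′, χ)` are isomorphic (`ε′_v = ε_v` iff `V_v` is isotropic); [Liu2021, Thm. D.6 (1) (l. 5436–5441)] and Rem. D.5 use the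
companion label `μᶜ·χ̌`, «again a conjugate-symplectic character of weight one», with CM type `Φ_{μᶜχ̌} = Φ_{μᶜ} = Φ̄_μ`
([Liu2021, Rem. 4.4]).  Here `χ̌(x) = χ(x_f/x_fᶜ)` ([Liu2021, App. D §D.1 (l. 5224)], ★ `HeckeCharacter.checkOfChi`).

THEOREMS ONLY (no definition, no named fact, no instance, no `sorry`; count-neutral).  The companion is written throughout as the
EXPLICIT PRODUCT TERM
`IdeleClassGroup.galConj 𝔠 μ * HarrisKudlaSweet1996.unitaryClassChar L (HeckeCharacter.checkOfChi hcc χ) hu`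
(`𝔠 = IsCMField.complexConj L`; ★ DEF `unitaryClassChar` = a unitary Hecke character read as a `C_L →ₜ* S¹`,
`RepresentationTheory/HarrisKudlaSweet1996/SplittingCharactersCM`; `hu : χ̌.IsUnitary`, supplied for a CM field by
`isUnitary_checkOfChi_cm` below from ★ `isUnitary_checkOfChi`), so that consumers may either name the term or take the ∃-package
`exists_companion_galConj_mul_checkOfChi`.

* §1 the unitary class character `η_χ := unitaryClassChar L χ̌ hu` of `χ̌`: `toHeckeCharacter η_χ = χ̌` (★), conjugate ORTHOGONAL,
  ∞-type `0` (★ `CheckOfChiConjugateOrthogonal` at `η := η_χ`), and `η_χᶜ = η_χ⁻¹` (★ `galConj_checkOfChi` `χ̌ᶜ = χ̌⁻¹` read through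
  ★ `toHeckeCharacter_injective`);
* §2 the companion `μ′ := μᶜ·η_χ`: `toHeckeCharacter μ′ = toHeckeCharacter (μᶜ) · χ̌ = (toHeckeCharacter μ)ᶜ · χ̌`; for `μ` conjugate-symplectic of weight `𝔴`:
  `μ′` is conjugate-symplectic (★ `IsConjugateSymplectic.galConj` + ★ `mul_isConjugateOrthogonal`), of weight `𝔴`
  (★ `hasWeight_galConj_iff` + ★ `HasWeight.mul_of_hasInfinityType_zero`), with `cmType = CMTypeOps.bar hμ.cmType`
  (★ `cmType_mul` + ★ `cmType_galConj`) and `infinityType = -hμ.infinityType`; membership form `τ ∈ Φ_{μ′} ↔ τ ∉ Φ_μ`;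
* §3 the relabel is an involution: `(μ′)ᶜ = μ·η_χ⁻¹`, `(μ′)ᶜ·η_χ = μ`, and the Hecke-level reading
  `toHeckeCharacter ((μ′)ᶜ) = toHeckeCharacter μ · χ̌⁻¹`;
* §4 the ∃-package `exists_companion_galConj_mul_checkOfChi`, uniqueness `eq_galConj_mul_unitaryClassChar_of_toHeckeCharacter_eq`,
  and the spec transfer `companion_spec_of_toHeckeCharacter_eq_galConj_mul_checkOfChi` (any `μ′` with that Hecke character is
  conjugate symplectic of the same weight and CM type `Φ̄_μ` — the carrier-agnostic consumer's hypotheses discharged from `hH` alone).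

Consumer (cell `hodgecm-mathlib`, d6 line, crux HLiu418 = stmt-HodgeConjecture-24832): the companion-character carrier named by the
`stub_S1b` next-run dossier (A-p03 (g12) `s1bShape_of_remD5`, preferred filing split `RemD5Normalised…` + `LemD14Relabel…`; census
`CENSUS-S1b-CaseB-relabel` §2 row 1).  HC_CM is proved only modulo the 7 printed citations until rung 0 closes; this file proves no
cell binder and moves no book.

## References
* [Liu2021] Y. Liu, *Fourier–Jacobi cycles and arithmetic relative trace formula*, Camb. J. Math. **9** (2021) = arXiv:2102.11518:
  Def. 4.1 (l. 1900–1902), Rem. 4.2, Def. 4.3 (l. 1914–1921), Rem. 4.4, App. D §D.1 (l. 5224), Lem. D.1 (4) (l. 5235),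
  Thm. D.6 (1) (l. 5436–5441).
* [WeilBNT1967] A. Weil, *Basic Number Theory* (1967), Ch. VII §3 (characters of the idèle class group).
-/

set_option autoImplicit false

noncomputable section

open NumberField

namespace Literature.NumberTheory.Automorphic.IdeleClassGroup

open Literature.NumberTheory.GaloisRepresentations
open Literature.NumberTheory.Automorphic.Liu2021 Literature.NumberTheory.Automorphic.Liu2021.Def411WeilCarriers
open Literature.NumberTheory.Automorphic.Liu2021.CheckOfChi
open Literature.RepresentationTheory.HarrisKudlaSweet1996 (unitaryClassChar toHeckeCharacter_unitaryClassChar)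
open Literature.NumberTheory.ComplexMultiplication (CMTypeOps.bar CMTypeOps.mem_bar_iff)

variable {L : Type} [Field L] [NumberField L] [IsCMField L]

/-! ## §0 Two pieces of plumbing -/

omit [IsCMField L] in
/-- `galConj σ` is multiplicative in the character: `(ψ·η) ∘ σ = (ψ ∘ σ)·(η ∘ σ)`. [folklore] [cite: Liu2021, §4.1 (l. 1912)] -/
theorem galConj_mul {K : Type} [Field K] [Algebra K L] (σ : L ≃ₐ[K] L) (ψ η : IdeleClassGroup L →ₜ* Circle) :
    galConj σ (ψ * η) = galConj σ ψ * galConj σ η :=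
  ContinuousMonoidHom.ext fun _ => rfl

omit [IsCMField L] in
/-- `galConj σ` commutes with inversion: `ψ⁻¹ ∘ σ = (ψ ∘ σ)⁻¹`. [folklore] [cite: Liu2021, §4.1 (l. 1912)] -/
theorem galConj_inv {K : Type} [Field K] [Algebra K L] (σ : L ≃ₐ[K] L) (ψ : IdeleClassGroup L →ₜ* Circle) :
    galConj σ ψ⁻¹ = (galConj σ ψ)⁻¹ :=
  ContinuousMonoidHom.ext fun _ => rfl

variable (hcc : IsCMField.complexConj L * IsCMField.complexConj L = 1)
  (χ : Chi ↥(maximalRealSubfield L) L (IsCMField.complexConj L))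

/-- **`χ̌` is unitary for a CM field `L/L⁺`** (★ `isUnitary_checkOfChi` at `[L : L⁺] = 2`, `𝔠 ≠ 1`): the hypothesis `hu` of every
statement below is available unconditionally. [cite: Liu2021, Def. 4.11 (l. 2090); App. D §D.1 (l. 5224)] -/
theorem isUnitary_checkOfChi_cm : (HeckeCharacter.checkOfChi hcc χ).IsUnitary :=
  isUnitary_checkOfChi (IsCMField.isQuadraticExtension L).finrank_eq_two (IsCMField.complexConj_ne_one L) hcc χ

variable (hu : (HeckeCharacter.checkOfChi hcc χ).IsUnitary)

/-! ## §1 The unitary idèle-class character `η_χ` of `χ̌` -/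

/-- `toHeckeCharacter η_χ = χ̌` for `η_χ := unitaryClassChar L χ̌ hu` (★ `toHeckeCharacter_unitaryClassChar`, restated at `χ̌` for
rewriting). [cite: WeilBNT1967, Ch. VII §3] [cite: Liu2021, App. D §D.1 (l. 5224)] -/
theorem toHeckeCharacter_unitaryClassChar_checkOfChi :
    toHeckeCharacter L (unitaryClassChar L (HeckeCharacter.checkOfChi hcc χ) hu) = HeckeCharacter.checkOfChi hcc χ :=
  toHeckeCharacter_unitaryClassChar L _ hu

/-- **`η_χ` is conjugate orthogonal** (`χ̌|_{𝕀_{L⁺}} = 1`). [cite: Liu2021, Def. 4.1 (l. 1900–1902); App. D §D.1 (l. 5224)] -/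
theorem isConjugateOrthogonal_unitaryClassChar_checkOfChi :
    IsConjugateOrthogonal L (unitaryClassChar L (HeckeCharacter.checkOfChi hcc χ) hu) :=
  isConjugateOrthogonal_of_toHeckeCharacter_eq_checkOfChi hcc χ (toHeckeCharacter_unitaryClassChar L _ hu)

/-- **`η_χ` has ∞-type `0`** (`χ̌_∞ = 1`). [cite: Liu2021, App. D §D.1 (l. 5224); Def. 4.3 (l. 1914–1921)] -/
theorem hasInfinityType_zero_unitaryClassChar_checkOfChi :
    HasInfinityType L (unitaryClassChar L (HeckeCharacter.checkOfChi hcc χ) hu) 0 :=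
  hasInfinityType_zero_of_toHeckeCharacter_eq_checkOfChi hcc χ (toHeckeCharacter_unitaryClassChar L _ hu)

/-- **`η_χᶜ = η_χ⁻¹`** (`χ̌ᶜ = χ̌⁻¹`, ★ `galConj_checkOfChi`, transported along ★ `toHeckeCharacter_injective`).
[cite: Liu2021, App. D §D.1 (l. 5224); Lem. D.1 (4) (l. 5235)] -/
theorem galConj_unitaryClassChar_checkOfChi :
    IdeleClassGroup.galConj (IsCMField.complexConj L) (unitaryClassChar L (HeckeCharacter.checkOfChi hcc χ) hu) =
      (unitaryClassChar L (HeckeCharacter.checkOfChi hcc χ) hu)⁻¹ :=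
  toHeckeCharacter_injective L (by
    rw [toHeckeCharacter_galConj, toHeckeCharacter_inv, toHeckeCharacter_unitaryClassChar, galConj_checkOfChi])

/-! ## §2 The companion `μ′ = μᶜ·η_χ` -/

variable (μ : IdeleClassGroup L →ₜ* Circle)

/-- **Hecke-level reading of the companion**: `toHeckeCharacter (μᶜ·η_χ) = toHeckeCharacter (μᶜ) · χ̌` — the spelling of the
carrier-agnostic hypothesis `hH` of the d6 line's `LemD14Relabel…` consumer. [cite: Liu2021, Lem. D.1 (4) (l. 5235); Thm. D.6 (1) (l. 5436–5441)] -/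
theorem toHeckeCharacter_galConj_mul_unitaryClassChar_checkOfChi :
    toHeckeCharacter L (IdeleClassGroup.galConj (IsCMField.complexConj L) μ * unitaryClassChar L (HeckeCharacter.checkOfChi hcc χ) hu) =
      toHeckeCharacter L (IdeleClassGroup.galConj (IsCMField.complexConj L) μ) * HeckeCharacter.checkOfChi hcc χ := by
  rw [toHeckeCharacter_mul, toHeckeCharacter_unitaryClassChar]

/-- The same with the first factor read as the Galois conjugate HECKE character: `toHeckeCharacter (μᶜ·η_χ) = (toHeckeCharacter μ)ᶜ · χ̌`
(★ `toHeckeCharacter_galConj`). [cite: Liu2021, §4.1 (l. 1912); Lem. D.1 (4) (l. 5235)] -/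
theorem toHeckeCharacter_galConj_mul_unitaryClassChar_checkOfChi_eq_galConj_mul :
    toHeckeCharacter L (IdeleClassGroup.galConj (IsCMField.complexConj L) μ * unitaryClassChar L (HeckeCharacter.checkOfChi hcc χ) hu) =
      HeckeCharacter.galConj (IsCMField.complexConj L) (toHeckeCharacter L μ) * HeckeCharacter.checkOfChi hcc χ := by
  rw [toHeckeCharacter_galConj_mul_unitaryClassChar_checkOfChi, toHeckeCharacter_galConj]

variable {μ}

/-- **The companion `μᶜ·χ̌` is conjugate symplectic** when `μ` is ([Liu2021, Rem. 4.4] for `μᶜ`, then the conjugate-orthogonal,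
archimedeanly trivial twist by `χ̌`). [cite: Liu2021, Rem. 4.4; Def. 4.1 (l. 1900–1902); Lem. D.1 (4) (l. 5235)] -/
theorem IsConjugateSymplectic.galConj_mul_unitaryClassChar_checkOfChi (hμ : IsConjugateSymplectic L μ) :
    IsConjugateSymplectic L
      (IdeleClassGroup.galConj (IsCMField.complexConj L) μ * unitaryClassChar L (HeckeCharacter.checkOfChi hcc χ) hu) :=
  hμ.galConj.mul_isConjugateOrthogonal (isConjugateOrthogonal_unitaryClassChar_checkOfChi hcc χ hu)

/-- **The companion has the same weight**: `HasWeight μ 𝔴 → HasWeight (μᶜ·χ̌) 𝔴` (in particular weight one stays weight one).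
[cite: Liu2021, Rem. 4.4; Def. 4.3 (l. 1914–1921); Thm. D.6 (1) (l. 5436)] -/
theorem HasWeight.galConj_mul_unitaryClassChar_checkOfChi {𝔴 : InfinitePlace L → ℕ} (hw : HasWeight L μ 𝔴) :
    HasWeight L (IdeleClassGroup.galConj (IsCMField.complexConj L) μ * unitaryClassChar L (HeckeCharacter.checkOfChi hcc χ) hu) 𝔴 :=
  (hasWeight_galConj_iff.2 hw).mul_of_hasInfinityType_zero (hasInfinityType_zero_unitaryClassChar_checkOfChi hcc χ hu)

/-- `HasWeight (μᶜ·χ̌) 𝔴 ↔ HasWeight μ 𝔴`. [cite: Liu2021, Rem. 4.4; Def. 4.3 (l. 1914–1921)] -/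
theorem hasWeight_galConj_mul_unitaryClassChar_checkOfChi_iff {𝔴 : InfinitePlace L → ℕ} :
    HasWeight L (IdeleClassGroup.galConj (IsCMField.complexConj L) μ * unitaryClassChar L (HeckeCharacter.checkOfChi hcc χ) hu) 𝔴 ↔
      HasWeight L μ 𝔴 := by
  rw [hasWeight_iff_of_toHeckeCharacter_eq hcc χ (μ := IdeleClassGroup.galConj (IsCMField.complexConj L) μ)
    (toHeckeCharacter_galConj_mul_unitaryClassChar_checkOfChi hcc χ hu μ), hasWeight_galConj_iff]

/-- **The companion has CM type `Φ̄_μ`**: `Φ_{μᶜ·χ̌} = Φ_{μᶜ} = CMTypeOps.bar Φ_μ`.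
[cite: Liu2021, Rem. 4.4; Def. 4.3 (l. 1914–1921); Lem. D.1 (4) (l. 5235)] -/
theorem IsConjugateSymplectic.cmType_galConj_mul_unitaryClassChar_checkOfChi (hμ : IsConjugateSymplectic L μ) :
    (hμ.galConj_mul_unitaryClassChar_checkOfChi hcc χ hu).cmType = CMTypeOps.bar hμ.cmType := by
  rw [← hμ.cmType_galConj]
  exact hμ.galConj.cmType_mul (isConjugateOrthogonal_unitaryClassChar_checkOfChi hcc χ hu)
    (hasInfinityType_zero_unitaryClassChar_checkOfChi hcc χ hu)

/-- Membership form: **`τ ∈ Φ_{μᶜ·χ̌} ↔ τ ∉ Φ_μ`**. [cite: Liu2021, Rem. 4.4; Def. 4.12] -/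
theorem IsConjugateSymplectic.mem_cmType_galConj_mul_unitaryClassChar_checkOfChi_iff (hμ : IsConjugateSymplectic L μ)
    (τ : L →+* ℂ) :
    τ ∈ (hμ.galConj_mul_unitaryClassChar_checkOfChi hcc χ hu).cmType.1 ↔ τ ∉ hμ.cmType.1 := by
  rw [hμ.cmType_galConj_mul_unitaryClassChar_checkOfChi hcc χ hu, CMTypeOps.mem_bar_iff]

/-- **The companion has ∞-type `−e_μ`** (as functions; `e_{μᶜ} = −e_μ`, unchanged by `χ̌`). [cite: Liu2021, Rem. 4.2; Rem. 4.4; Def. 4.3] -/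
theorem IsConjugateSymplectic.infinityType_galConj_mul_unitaryClassChar_checkOfChi (hμ : IsConjugateSymplectic L μ) :
    (hμ.galConj_mul_unitaryClassChar_checkOfChi hcc χ hu).infinityType = -hμ.infinityType := by
  rw [← hμ.infinityType_galConj]
  exact hμ.galConj.infinityType_mul (isConjugateOrthogonal_unitaryClassChar_checkOfChi hcc χ hu)
    (hasInfinityType_zero_unitaryClassChar_checkOfChi hcc χ hu)

/-- The companion has the same `weightOf` (as a function). [cite: Liu2021, Rem. 4.4; Def. 4.3] -/
theorem IsConjugateSymplectic.weightOf_galConj_mul_unitaryClassChar_checkOfChi (hμ : IsConjugateSymplectic L μ) :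
    (hμ.galConj_mul_unitaryClassChar_checkOfChi hcc χ hu).weightOf = hμ.weightOf := by
  rw [← hμ.weightOf_galConj]
  exact hμ.galConj.weightOf_mul (isConjugateOrthogonal_unitaryClassChar_checkOfChi hcc χ hu)
    (hasInfinityType_zero_unitaryClassChar_checkOfChi hcc χ hu)

/-! ## §3 The relabel `μ ↦ μᶜ·χ̌` is an involution -/

variable (μ)

/-- **`(μᶜ·η_χ)ᶜ = μ·η_χ⁻¹`**. [cite: Liu2021, Rem. 4.4; Lem. D.1 (4) (l. 5235)] -/
theorem galConj_galConj_mul_unitaryClassChar_checkOfChi :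
    IdeleClassGroup.galConj (IsCMField.complexConj L)
        (IdeleClassGroup.galConj (IsCMField.complexConj L) μ * unitaryClassChar L (HeckeCharacter.checkOfChi hcc χ) hu) =
      μ * (unitaryClassChar L (HeckeCharacter.checkOfChi hcc χ) hu)⁻¹ := by
  rw [galConj_mul, galConj_complexConj_galConj_complexConj, galConj_unitaryClassChar_checkOfChi]

/-- **The companion of the companion is `μ`**: `(μᶜ·η_χ)ᶜ·η_χ = μ`. [cite: Liu2021, Lem. D.1 (4) (l. 5235)] -/
theorem galConj_galConj_mul_unitaryClassChar_checkOfChi_mul :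
    IdeleClassGroup.galConj (IsCMField.complexConj L)
          (IdeleClassGroup.galConj (IsCMField.complexConj L) μ * unitaryClassChar L (HeckeCharacter.checkOfChi hcc χ) hu) *
        unitaryClassChar L (HeckeCharacter.checkOfChi hcc χ) hu = μ := by
  rw [galConj_galConj_mul_unitaryClassChar_checkOfChi, inv_mul_cancel_right]

/-- Hecke-level reading of the conjugate companion: `toHeckeCharacter ((μᶜ·η_χ)ᶜ) = toHeckeCharacter μ · χ̌⁻¹` — the label under
which the tree's carriers (keyed on `toHeckeCharacter (galConj 𝔠 ·)`) see the companion. [cite: Liu2021, Lem. D.1 (4) (l. 5235); Thm. D.6 (1) (l. 5441)] -/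
theorem toHeckeCharacter_galConj_galConj_mul_unitaryClassChar_checkOfChi :
    toHeckeCharacter L (IdeleClassGroup.galConj (IsCMField.complexConj L)
        (IdeleClassGroup.galConj (IsCMField.complexConj L) μ * unitaryClassChar L (HeckeCharacter.checkOfChi hcc χ) hu)) =
      toHeckeCharacter L μ * (HeckeCharacter.checkOfChi hcc χ)⁻¹ := by
  rw [galConj_galConj_mul_unitaryClassChar_checkOfChi, toHeckeCharacter_mul, toHeckeCharacter_inv,
    toHeckeCharacter_unitaryClassChar]

/-! ## §4 ∃-package and uniqueness -/

variable {μ}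

/-- **The companion character exists** (∃-package for consumers that do not want to name the term): for `μ` conjugate symplectic of
weight `𝔴` there is a unitary idèle-class character `μ′` with `toHeckeCharacter μ′ = (toHeckeCharacter μ)ᶜ·χ̌`, conjugate symplectic, of
weight `𝔴`, and of CM type `Φ̄_μ`. [cite: Liu2021, Rem. 4.4; Lem. D.1 (4) (l. 5235); Thm. D.6 (1) (l. 5436–5441)] -/
theorem IsConjugateSymplectic.exists_companion_galConj_mul_checkOfChi (hμ : IsConjugateSymplectic L μ)
    {𝔴 : InfinitePlace L → ℕ} (hw : HasWeight L μ 𝔴) :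
    ∃ μ' : IdeleClassGroup L →ₜ* Circle,
      toHeckeCharacter L μ' =
          toHeckeCharacter L (IdeleClassGroup.galConj (IsCMField.complexConj L) μ) * HeckeCharacter.checkOfChi hcc χ ∧
        ∃ hμ' : IsConjugateSymplectic L μ', HasWeight L μ' 𝔴 ∧ hμ'.cmType = CMTypeOps.bar hμ.cmType :=
  ⟨_, toHeckeCharacter_galConj_mul_unitaryClassChar_checkOfChi hcc χ (isUnitary_checkOfChi_cm hcc χ) μ,
    hμ.galConj_mul_unitaryClassChar_checkOfChi hcc χ _, hw.galConj_mul_unitaryClassChar_checkOfChi hcc χ _,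
    hμ.cmType_galConj_mul_unitaryClassChar_checkOfChi hcc χ _⟩

/-- **Uniqueness of the companion**: a unitary idèle-class character `μ′` with `toHeckeCharacter μ′ = toHeckeCharacter (μᶜ)·χ̌` IS the
product term (★ `toHeckeCharacter_injective`) — so the four carrier-agnostic hypotheses `(h′, hw′, hΦ′, hH)` of a consumer determine `μ′`.
[cite: WeilBNT1967, Ch. VII §3] [cite: Liu2021, Lem. D.1 (4) (l. 5235)] -/
theorem eq_galConj_mul_unitaryClassChar_of_toHeckeCharacter_eq {μ' : IdeleClassGroup L →ₜ* Circle}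
    (h : toHeckeCharacter L μ' =
      toHeckeCharacter L (IdeleClassGroup.galConj (IsCMField.complexConj L) μ) * HeckeCharacter.checkOfChi hcc χ) :
    μ' = IdeleClassGroup.galConj (IsCMField.complexConj L) μ * unitaryClassChar L (HeckeCharacter.checkOfChi hcc χ) hu :=
  toHeckeCharacter_injective L (by rw [h, toHeckeCharacter_galConj_mul_unitaryClassChar_checkOfChi])

/-- **Spec transfer along `hH`** (the consumer's direction): ANY `μ′` with `toHeckeCharacter μ′ = toHeckeCharacter (μᶜ)·χ̌` is conjugate
symplectic, of the weight of `μ`, and of CM type `Φ̄_μ` — the three remaining hypotheses `(h′, hw′, hΦ′)` of the carrier-agnostic consumer,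
DISCHARGED from `hH` alone. [cite: Liu2021, Rem. 4.4; Lem. D.1 (4) (l. 5235); Thm. D.6 (1) (l. 5436–5441)] -/
theorem IsConjugateSymplectic.companion_spec_of_toHeckeCharacter_eq_galConj_mul_checkOfChi (hμ : IsConjugateSymplectic L μ)
    {𝔴 : InfinitePlace L → ℕ} (hw : HasWeight L μ 𝔴) {μ' : IdeleClassGroup L →ₜ* Circle}
    (h : toHeckeCharacter L μ' =
      toHeckeCharacter L (IdeleClassGroup.galConj (IsCMField.complexConj L) μ) * HeckeCharacter.checkOfChi hcc χ) :
    ∃ hμ' : IsConjugateSymplectic L μ', HasWeight L μ' 𝔴 ∧ hμ'.cmType = CMTypeOps.bar hμ.cmType := by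
  obtain rfl := eq_galConj_mul_unitaryClassChar_of_toHeckeCharacter_eq hcc χ (isUnitary_checkOfChi_cm hcc χ) h
  exact ⟨hμ.galConj_mul_unitaryClassChar_checkOfChi hcc χ _, hw.galConj_mul_unitaryClassChar_checkOfChi hcc χ _,
    hμ.cmType_galConj_mul_unitaryClassChar_checkOfChi hcc χ _⟩

/-! ## §5 The INVERSE companion `μᶜ·η_χ⁻¹ = (μ·η_χ)ᶜ` — the partner label in the tree's carrier dictionary

Edition 2 (append-only).  The tree's global oscillator carriers are keyed on the splitting Hecke character
`toHeckeCharacter (galConj 𝔠 ·)` of a label; the referees' ≤-print reads of the d6 line's `LemD14RelabelShape` (ref2 (g12) l15 (ii),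
REF1 (g12) m02, 2026-08-30) pin the partner label whose carrier is Hecke-isomorphic to that of `μ` as `μ″ := μᶜ·η_χ⁻¹` — split-place
principal-series parameters `{μ_{H,w}·χ̌_w, μ_{H,w}⁻¹}` on both sides ([Liu2021, proof of Lem. D.1, l. 5241]) — i.e. the repaired hypothesis is
(α) `toHeckeCharacter μ″ = toHeckeCharacter (μᶜ)·χ̌⁻¹`, equivalently (β) `toHeckeCharacter ((μ″)ᶜ) = toHeckeCharacter μ·χ̌`.  This section
supplies, for the explicit term `galConj 𝔠 μ * (unitaryClassChar L χ̌ hu)⁻¹`, both spellings, the spec (conjugate symplectic, same weight, CM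
type `Φ̄_μ` — `Φ` is blind to the exponent of `χ̌`), the ∃-packages keyed on (α) and on (β), uniqueness, and the spec transfer from either
hypothesis alone. -/

variable (μ)

/-- **(α) spelling of the inverse companion**: `toHeckeCharacter (μᶜ·η_χ⁻¹) = toHeckeCharacter (μᶜ) · χ̌⁻¹`.
[cite: Liu2021, Lem. D.1 (4) (l. 5235); proof of Lem. D.1 (l. 5241); proof of Prop. D.4 (1) (l. 5392)] -/
theorem toHeckeCharacter_galConj_mul_unitaryClassChar_checkOfChi_inv :
    toHeckeCharacter L (IdeleClassGroup.galConj (IsCMField.complexConj L) μ * (unitaryClassChar L (HeckeCharacter.checkOfChi hcc χ) hu)⁻¹) =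
      toHeckeCharacter L (IdeleClassGroup.galConj (IsCMField.complexConj L) μ) * (HeckeCharacter.checkOfChi hcc χ)⁻¹ := by
  rw [toHeckeCharacter_mul, toHeckeCharacter_inv, toHeckeCharacter_unitaryClassChar]

/-- **The inverse companion is the conjugate of the direct twist**: `μᶜ·η_χ⁻¹ = (μ·η_χ)ᶜ` (`η_χᶜ = η_χ⁻¹`).
[cite: Liu2021, Rem. 4.4; Lem. D.1 (4) (l. 5235)] -/
theorem galConj_mul_unitaryClassChar_checkOfChi_inv_eq_galConj_mul :
    IdeleClassGroup.galConj (IsCMField.complexConj L) μ * (unitaryClassChar L (HeckeCharacter.checkOfChi hcc χ) hu)⁻¹ =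
      IdeleClassGroup.galConj (IsCMField.complexConj L) (μ * unitaryClassChar L (HeckeCharacter.checkOfChi hcc χ) hu) := by
  rw [galConj_mul, galConj_unitaryClassChar_checkOfChi]

/-- **`((μᶜ·η_χ⁻¹))ᶜ = μ·η_χ`**. [cite: Liu2021, Rem. 4.4; Lem. D.1 (4) (l. 5235)] -/
theorem galConj_galConj_mul_unitaryClassChar_checkOfChi_inv :
    IdeleClassGroup.galConj (IsCMField.complexConj L)
        (IdeleClassGroup.galConj (IsCMField.complexConj L) μ * (unitaryClassChar L (HeckeCharacter.checkOfChi hcc χ) hu)⁻¹) =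
      μ * unitaryClassChar L (HeckeCharacter.checkOfChi hcc χ) hu := by
  rw [galConj_mul_unitaryClassChar_checkOfChi_inv_eq_galConj_mul, galConj_complexConj_galConj_complexConj]

/-- **(β) spelling of the inverse companion** (on the tree's NATIVE splitting labels): `toHeckeCharacter ((μᶜ·η_χ⁻¹)ᶜ) = toHeckeCharacter μ · χ̌`.
[cite: Liu2021, Lem. D.1 (4) (l. 5235); proof of Lem. D.1 (l. 5241); proof of Prop. D.4 (1) (l. 5392)] -/
theorem toHeckeCharacter_galConj_galConj_mul_unitaryClassChar_checkOfChi_inv :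
    toHeckeCharacter L (IdeleClassGroup.galConj (IsCMField.complexConj L)
        (IdeleClassGroup.galConj (IsCMField.complexConj L) μ * (unitaryClassChar L (HeckeCharacter.checkOfChi hcc χ) hu)⁻¹)) =
      toHeckeCharacter L μ * HeckeCharacter.checkOfChi hcc χ := by
  rw [galConj_galConj_mul_unitaryClassChar_checkOfChi_inv, toHeckeCharacter_mul, toHeckeCharacter_unitaryClassChar]

variable {μ}

/-- **The inverse companion `μᶜ·χ̌⁻¹` is conjugate symplectic** when `μ` is. [cite: Liu2021, Rem. 4.4; Def. 4.1 (l. 1900–1902); Lem. D.1 (4) (l. 5235)] -/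
theorem IsConjugateSymplectic.galConj_mul_unitaryClassChar_checkOfChi_inv (hμ : IsConjugateSymplectic L μ) :
    IsConjugateSymplectic L
      (IdeleClassGroup.galConj (IsCMField.complexConj L) μ * (unitaryClassChar L (HeckeCharacter.checkOfChi hcc χ) hu)⁻¹) :=
  hμ.galConj.mul_isConjugateOrthogonal (isConjugateOrthogonal_unitaryClassChar_checkOfChi hcc χ hu).inv

/-- **The inverse companion has the same weight**: `HasWeight μ 𝔴 → HasWeight (μᶜ·χ̌⁻¹) 𝔴`. [cite: Liu2021, Rem. 4.4; Def. 4.3 (l. 1914–1921)] -/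
theorem HasWeight.galConj_mul_unitaryClassChar_checkOfChi_inv {𝔴 : InfinitePlace L → ℕ} (hw : HasWeight L μ 𝔴) :
    HasWeight L (IdeleClassGroup.galConj (IsCMField.complexConj L) μ * (unitaryClassChar L (HeckeCharacter.checkOfChi hcc χ) hu)⁻¹) 𝔴 := by
  have h0 := (hasInfinityType_zero_unitaryClassChar_checkOfChi hcc χ hu).inv
  rw [neg_zero] at h0
  exact (hasWeight_galConj_iff.2 hw).mul_of_hasInfinityType_zero h0

/-- **The inverse companion has CM type `Φ̄_μ`** (the CM type is blind to the exponent of `χ̌`). [cite: Liu2021, Rem. 4.4; Def. 4.3 (l. 1914–1921); Lem. D.1 (4) (l. 5235)] -/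
theorem IsConjugateSymplectic.cmType_galConj_mul_unitaryClassChar_checkOfChi_inv (hμ : IsConjugateSymplectic L μ) :
    (hμ.galConj_mul_unitaryClassChar_checkOfChi_inv hcc χ hu).cmType = CMTypeOps.bar hμ.cmType := by
  have h0 := (hasInfinityType_zero_unitaryClassChar_checkOfChi hcc χ hu).inv
  rw [neg_zero] at h0
  rw [← hμ.cmType_galConj]
  exact hμ.galConj.cmType_mul (isConjugateOrthogonal_unitaryClassChar_checkOfChi hcc χ hu).inv h0

/-- Membership form for the inverse companion: **`τ ∈ Φ_{μᶜ·χ̌⁻¹} ↔ τ ∉ Φ_μ`**. [cite: Liu2021, Rem. 4.4; Def. 4.12] -/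
theorem IsConjugateSymplectic.mem_cmType_galConj_mul_unitaryClassChar_checkOfChi_inv_iff (hμ : IsConjugateSymplectic L μ)
    (τ : L →+* ℂ) :
    τ ∈ (hμ.galConj_mul_unitaryClassChar_checkOfChi_inv hcc χ hu).cmType.1 ↔ τ ∉ hμ.cmType.1 := by
  rw [hμ.cmType_galConj_mul_unitaryClassChar_checkOfChi_inv hcc χ hu, CMTypeOps.mem_bar_iff]

/-- **∃-package keyed on (α)**: for `μ` conjugate symplectic of weight `𝔴` there is `μ″` with `toHeckeCharacter μ″ = toHeckeCharacter (μᶜ)·χ̌⁻¹`,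
conjugate symplectic, of weight `𝔴`, of CM type `Φ̄_μ`. [cite: Liu2021, Rem. 4.4; Lem. D.1 (4) (l. 5235); proof of Prop. D.4 (1) (l. 5392)] -/
theorem IsConjugateSymplectic.exists_companion_galConj_mul_checkOfChi_inv (hμ : IsConjugateSymplectic L μ)
    {𝔴 : InfinitePlace L → ℕ} (hw : HasWeight L μ 𝔴) :
    ∃ μ'' : IdeleClassGroup L →ₜ* Circle,
      toHeckeCharacter L μ'' =
          toHeckeCharacter L (IdeleClassGroup.galConj (IsCMField.complexConj L) μ) * (HeckeCharacter.checkOfChi hcc χ)⁻¹ ∧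
        ∃ hμ'' : IsConjugateSymplectic L μ'', HasWeight L μ'' 𝔴 ∧ hμ''.cmType = CMTypeOps.bar hμ.cmType :=
  ⟨_, toHeckeCharacter_galConj_mul_unitaryClassChar_checkOfChi_inv hcc χ (isUnitary_checkOfChi_cm hcc χ) μ,
    hμ.galConj_mul_unitaryClassChar_checkOfChi_inv hcc χ _, hw.galConj_mul_unitaryClassChar_checkOfChi_inv hcc χ _,
    hμ.cmType_galConj_mul_unitaryClassChar_checkOfChi_inv hcc χ _⟩

/-- **∃-package keyed on (β)**: for `μ` conjugate symplectic of weight `𝔴` there is `μ″` with `toHeckeCharacter ((μ″)ᶜ) = toHeckeCharacter μ·χ̌`,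
conjugate symplectic, of weight `𝔴`, of CM type `Φ̄_μ`. [cite: Liu2021, Rem. 4.4; Lem. D.1 (4) (l. 5235); proof of Prop. D.4 (1) (l. 5392)] -/
theorem IsConjugateSymplectic.exists_companion_galConj_eq_mul_checkOfChi (hμ : IsConjugateSymplectic L μ)
    {𝔴 : InfinitePlace L → ℕ} (hw : HasWeight L μ 𝔴) :
    ∃ μ'' : IdeleClassGroup L →ₜ* Circle,
      toHeckeCharacter L (IdeleClassGroup.galConj (IsCMField.complexConj L) μ'') =
          toHeckeCharacter L μ * HeckeCharacter.checkOfChi hcc χ ∧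
        ∃ hμ'' : IsConjugateSymplectic L μ'', HasWeight L μ'' 𝔴 ∧ hμ''.cmType = CMTypeOps.bar hμ.cmType :=
  ⟨_, toHeckeCharacter_galConj_galConj_mul_unitaryClassChar_checkOfChi_inv hcc χ (isUnitary_checkOfChi_cm hcc χ) μ,
    hμ.galConj_mul_unitaryClassChar_checkOfChi_inv hcc χ _, hw.galConj_mul_unitaryClassChar_checkOfChi_inv hcc χ _,
    hμ.cmType_galConj_mul_unitaryClassChar_checkOfChi_inv hcc χ _⟩

/-- **Uniqueness from (α)**: `toHeckeCharacter μ″ = toHeckeCharacter (μᶜ)·χ̌⁻¹` forces `μ″ = μᶜ·η_χ⁻¹`. [cite: WeilBNT1967, Ch. VII §3] [cite: Liu2021, Lem. D.1 (4) (l. 5235)] -/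
theorem eq_galConj_mul_unitaryClassChar_inv_of_toHeckeCharacter_eq {μ'' : IdeleClassGroup L →ₜ* Circle}
    (h : toHeckeCharacter L μ'' =
      toHeckeCharacter L (IdeleClassGroup.galConj (IsCMField.complexConj L) μ) * (HeckeCharacter.checkOfChi hcc χ)⁻¹) :
    μ'' = IdeleClassGroup.galConj (IsCMField.complexConj L) μ * (unitaryClassChar L (HeckeCharacter.checkOfChi hcc χ) hu)⁻¹ :=
  toHeckeCharacter_injective L (by rw [h, toHeckeCharacter_galConj_mul_unitaryClassChar_checkOfChi_inv])

/-- **Uniqueness from (β)**: `toHeckeCharacter ((μ″)ᶜ) = toHeckeCharacter μ·χ̌` forces `μ″ = μᶜ·η_χ⁻¹` (conjugate both sides; `c² = 1`).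
[cite: WeilBNT1967, Ch. VII §3] [cite: Liu2021, Lem. D.1 (4) (l. 5235)] -/
theorem eq_galConj_mul_unitaryClassChar_inv_of_toHeckeCharacter_galConj_eq {μ'' : IdeleClassGroup L →ₜ* Circle}
    (h : toHeckeCharacter L (IdeleClassGroup.galConj (IsCMField.complexConj L) μ'') =
      toHeckeCharacter L μ * HeckeCharacter.checkOfChi hcc χ) :
    μ'' = IdeleClassGroup.galConj (IsCMField.complexConj L) μ * (unitaryClassChar L (HeckeCharacter.checkOfChi hcc χ) hu)⁻¹ := by
  have h1 : IdeleClassGroup.galConj (IsCMField.complexConj L) μ'' = μ * unitaryClassChar L (HeckeCharacter.checkOfChi hcc χ) hu :=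
    toHeckeCharacter_injective L (by rw [h, toHeckeCharacter_mul, toHeckeCharacter_unitaryClassChar])
  have h2 := congrArg (IdeleClassGroup.galConj (IsCMField.complexConj L)) h1
  rw [galConj_complexConj_galConj_complexConj] at h2
  rw [h2, galConj_mul_unitaryClassChar_checkOfChi_inv_eq_galConj_mul]

/-- **Spec transfer from (α) alone**: any `μ″` with `toHeckeCharacter μ″ = toHeckeCharacter (μᶜ)·χ̌⁻¹` is conjugate symplectic, of the weight of
`μ`, and of CM type `Φ̄_μ`. [cite: Liu2021, Rem. 4.4; Lem. D.1 (4) (l. 5235); proof of Prop. D.4 (1) (l. 5392)] -/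
theorem IsConjugateSymplectic.companion_spec_of_toHeckeCharacter_eq_galConj_mul_checkOfChi_inv (hμ : IsConjugateSymplectic L μ)
    {𝔴 : InfinitePlace L → ℕ} (hw : HasWeight L μ 𝔴) {μ'' : IdeleClassGroup L →ₜ* Circle}
    (h : toHeckeCharacter L μ'' =
      toHeckeCharacter L (IdeleClassGroup.galConj (IsCMField.complexConj L) μ) * (HeckeCharacter.checkOfChi hcc χ)⁻¹) :
    ∃ hμ'' : IsConjugateSymplectic L μ'', HasWeight L μ'' 𝔴 ∧ hμ''.cmType = CMTypeOps.bar hμ.cmType := by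
  obtain rfl := eq_galConj_mul_unitaryClassChar_inv_of_toHeckeCharacter_eq hcc χ (isUnitary_checkOfChi_cm hcc χ) h
  exact ⟨hμ.galConj_mul_unitaryClassChar_checkOfChi_inv hcc χ _, hw.galConj_mul_unitaryClassChar_checkOfChi_inv hcc χ _,
    hμ.cmType_galConj_mul_unitaryClassChar_checkOfChi_inv hcc χ _⟩

/-- **Spec transfer from (β) alone**: any `μ″` with `toHeckeCharacter ((μ″)ᶜ) = toHeckeCharacter μ·χ̌` is conjugate symplectic, of the weight of
`μ`, and of CM type `Φ̄_μ`. [cite: Liu2021, Rem. 4.4; Lem. D.1 (4) (l. 5235); proof of Prop. D.4 (1) (l. 5392)] -/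
theorem IsConjugateSymplectic.companion_spec_of_toHeckeCharacter_galConj_eq_mul_checkOfChi (hμ : IsConjugateSymplectic L μ)
    {𝔴 : InfinitePlace L → ℕ} (hw : HasWeight L μ 𝔴) {μ'' : IdeleClassGroup L →ₜ* Circle}
    (h : toHeckeCharacter L (IdeleClassGroup.galConj (IsCMField.complexConj L) μ'') =
      toHeckeCharacter L μ * HeckeCharacter.checkOfChi hcc χ) :
    ∃ hμ'' : IsConjugateSymplectic L μ'', HasWeight L μ'' 𝔴 ∧ hμ''.cmType = CMTypeOps.bar hμ.cmType := by
  obtain rfl := eq_galConj_mul_unitaryClassChar_inv_of_toHeckeCharacter_galConj_eq hcc χ (isUnitary_checkOfChi_cm hcc χ) h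
  exact ⟨hμ.galConj_mul_unitaryClassChar_checkOfChi_inv hcc χ _, hw.galConj_mul_unitaryClassChar_checkOfChi_inv hcc χ _,
    hμ.cmType_galConj_mul_unitaryClassChar_checkOfChi_inv hcc χ _⟩

end Literature.NumberTheory.Automorphic.IdeleClassGroup

end
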